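import Literature.Analysis.FluidPDE.SereginZajaczkowski2007L42Vorticity
import Literature.Analysis.FluidPDE.NSVorticityOfSmoothRepresentative
import Literature.Analysis.FluidPDE.AxisymPoloidalPart
import Literature.Analysis.FluidPDE.HessianLaplacian
import HarnessLib

/-!
# Seregin–Zajaczkowski 2007, the equation (4.5) for `χ = ω_φ`: proof

G. Seregin, W. Zajaczkowski, *A sufficient condition of regularity for axially symmetric
solutions to the Navier–Stokes equations*, SIAM J. Math. Anal. 39 (2007) 669–685 =
arXiv:math/0702720, §4, proof of Lemma 4.2 (arXiv p. 12): "Let us denote by `ω` the vorticity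
of `v`, i.e., `ω = ∇ ∧ v`. For `χ = ω_φ`, `V_ϱ`, and `V₃`, we have the following identities:
`V_{ϱ,ϱ} + V_{3,3} = -(1/ϱ) V_ϱ` (4.3), `V_{ϱ,3} - V_{3,ϱ} = χ` (4.4),
`∂_t χ + V_ϱ χ_{,ϱ} + V₃ χ_{,3} - (1/ϱ) χ V_ϱ - (χ_{,ϱϱ} + χ_{,33} + (1/ϱ) χ_{,ϱ} - χ/ϱ²)
  = (2/ϱ) V_φ V_{φ,3}` (4.5)."

This file PROVES the named fact `AngularVorticityEquation` of the sibling file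
`SereginZajaczkowski2007L42Vorticity.lean` (`AngularVorticityEquation_holds`): for the hypothesis
class `IsSmoothAxisymmetricSolutionOn Q̃ V P` of Prop. 4.1 (`Q̃ = ]-2², 0[ × 𝒞(1/4, 3; 2)`; a
suitable weak solution, axially symmetric, with `C^∞` slices all of whose spatial derivatives are
jointly continuous — no time derivative assumed), the angular vorticity
`χ(t, x) = ω_φ = angularVorticity (V t) x` has a classical time derivative on `Q̃` and satisfies
(4.5) at every point of `Q̃`, in the Cartesian rendering and with the regularity recorded in
`AngularVorticityEqOn`.

## The proof

1. **The classical vorticity equation for the class.** The tree's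
   `vorticity_classical_of_isDistributionalNSSolutionOn` (`NSVorticityOfSmoothRepresentative.lean`:
   the momentum equation tested with curls of test fields kills the pressure; slicewise
   integration by parts; du Bois-Reymond in time) applies verbatim to the class on the product
   region `Q̃ = I × S`: `ω = curl V` is jointly `C¹` on `Q̃` and `s ↦ ω(s, x)` has derivative
   `Δω - (V·∇)ω + (ω·∇)V` at every `(t, x) ∈ Q̃`.
2. **The `e_φ`-component in cylindrical form** (`inv_cylRadius_mul_inner_rotGen_vorticityRHS`,
   the content of "(4.5)"). With the infinitesimal rotation `Jx = (-x₁, x₀, 0) = ϱ e_φ` and the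
   junk-free swirls `η = ⟪Jx, ω⟫ = ϱ ω_φ`, `Γ = ⟪Jx, V⟫ = ϱ V_φ` one has, as identities of
   functions, `ω_φ = ϱ⁻¹ η`, `V_φ = ϱ⁻¹ Γ` (`angularVorticity_eq_inv_mul_swirl`,
   `swirlVelocity_eq_inv_mul_swirl`). At a point `x` off the axis where `V(t, ·)` and `ω(t, ·)`
   are infinitesimally axisymmetric (`DV[Jx] = JV`, `Dω[Jx] = Jω`; the slices are axially
   symmetric on the rotation-invariant shell, `fderiv_rotGen_of_forall_rotZ`,
   `curl_rotZ_of_forall_mem`):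
   `⟪Jx, Δω⟫ = Δη - 2(∂₀ω₁ - ∂₁ω₀) = Δη - (2/ϱ) ∂_{e_r}η` (the tree's `laplacian_swirl` and
   `fderiv_swirl_eR_of_fderiv_rotGen`), `⟪Jx, Dω[V]⟫ = Dη[V] - ⟪JV, ω⟫`,
   `⟪Jx, DV[ω]⟫ = ⟪ω, DV(Jx)⟫ = ⟪ω, JV⟫` (the tree's `inner_apply_curlCLM`), Lagrange's identity
   `ϱ²⟪JV, ω⟫ = ⟪x_h, V⟫ η - Γ ⟪x_h, ω⟫` (the tree's `cylRadius_sq_mul_inner_rotGen`) with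
   `⟪x_h, ω⟫ = -∂₃Γ` (`ω_r = -∂₃V_φ`, the tree's `inner_curl_horizontal`), and, for `ω_φ = ϱ⁻¹η`,
   `Dω_φ = ϱ⁻¹Dη - ηϱ⁻²⟪e_r, ·⟫`, `Δω_φ = ϱ⁻¹Δη - 2ϱ⁻²∂_{e_r}η + ϱ⁻³η`
   (`laplacian_angularVorticity`: the Leibniz rule `laplacian_mul_eq` of the tree applied to global
   `C²` representatives of `ϱ⁻¹` and `ω` near `x`, and `Δ(ϱ⁻¹) = ϱ⁻³`, `laplacian_inv_cylRadius`).
   Summing up,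
   `ϱ⁻¹⟪Jx, Δω - Dω[V] + DV[ω]⟫ + Dω_φ[V] - V_ϱ ω_φ/ϱ - Δω_φ + ω_φ/ϱ² = (2/ϱ) V_φ ∂₃V_φ`,
   which is (4.5) once `∂ₜω_φ = ϱ⁻¹⟪Jx, ∂ₜω⟫` is substituted.
3. **Regularity.** `(t, x) ↦ ω_φ = ϱ⁻¹⟪Jx, ω(t, x)⟫` is jointly `C¹` on `Q̃`, whence the
   continuity of `ω_φ`, `D_xω_φ` and `∂ₜω_φ` (slices of the joint derivative); the slices
   `ω_φ(t, ·)` are `C²` at the points of `Q̃`; `Δ_xω_φ` is continuous on `Q̃` by the formula of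
   `laplacian_angularVorticity` and the joint continuity of `ω`, `D_xω`, `Δ_xω`.

## Mathlib / tree search

Tree: `vorticity_classical_of_isDistributionalNSSolutionOn` and the bridges
`continuousOn_iteratedFDeriv_clm_comp`, `continuousOn_laplacian_of_continuousOn_iteratedFDeriv_two`,
`ContDiffOn.exists_contDiff_eqOn_nhds_of_isCompact`, `contDiffOn_curl_two`
(`NSVorticityOfSmoothRepresentative`, `NSLocalLerayFarFieldVorticity`); `laplacian_swirl`,
`fderiv_swirl_apply`, `IsAxisymmetric.fderiv_rotGen` (global symmetry; localised here),
`hasDerivAt_rotZ_zero` (`SwirlTransportProofs`); `inner_apply_curlCLM`, `curlCLM_rotZL_conj`,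
`cylRadius_sq_mul_inner_rotGen`, `inner_curl_horizontal` (`AxisymmetricVorticityTransport`);
`hasFDerivAt_cylRadius` (`MeridianReduction`), `contDiffAt_cylRadius` (`SwirlCutoff`),
`contDiffAt_swirl` (`AxisymPoloidalPart`), `laplacian_mul_eq` (`HessianLaplacian`). Mathlib:
`InnerProductSpace.laplacian_congr_nhds`, `laplacian_eq_iteratedFDeriv_orthonormalBasis`,
`iteratedFDeriv_two_apply`, `fderiv_clm_apply`, `hasFDerivAt_inv`, `HasFDerivAt.pow`,
`ContDiffOn.continuousOn_fderiv_of_isOpen`, `hasFDerivAt_prodMk_right`, `HasDerivAt.prodMk`.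

## References

* G. Seregin, W. Zajaczkowski, SIAM J. Math. Anal. 39 (2007) 669–685, arXiv:math/0702720, §4:
  proof of Lemma 4.2, (4.3)–(4.5) (arXiv p. 12). [`SereginZajaczkowski2007`]
* A. J. Majda, A. L. Bertozzi, *Vorticity and Incompressible Flow*, CUP 2002, §2.3.3 (the
  vorticity equation of axisymmetric flows with swirl in cylindrical components).
* P. G. Lemarié-Rieusset, *The Navier–Stokes Problem in the 21st Century* (2016), Thm. 13.1,
  proof, Step 1 (taking the curl of the equations to remove the pressure). [`LemarieRieusset2016`]
-/

noncomputable section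

open MeasureTheory Set Function Filter Topology TopologicalSpace Metric WithLp
open scoped NNReal ENNReal ContDiff InnerProductSpace RealInnerProductSpace Laplacian

namespace Literature.Analysis.FluidPDE

namespace SereginZajaczkowski2007

open SereginSverak2009

/-! ### Cylindrical components as multiples of junk-free polynomial pairings -/

/-- `⟪x_h, v⟫ = x₀v₀ + x₁v₁` for the horizontal position vector `x_h = (x₀, x₁, 0)`. [folklore] -/
theorem inner_horizontal_left (x v : EuclideanSpace ℝ (Fin 3)) :
    ⟪(toLp 2 ![x 0, x 1, 0] : EuclideanSpace ℝ (Fin 3)), v⟫ = x 0 * v 0 + x 1 * v 1 := by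
  simp only [PiLp.inner_apply, RCLike.inner_apply, conj_trivial, Fin.sum_univ_three,
    Matrix.cons_val_zero, Matrix.cons_val_one, Matrix.cons_val_two, Matrix.head_cons,
    Matrix.tail_cons]
  ring

/-- `⟪e_r(x), v⟫ = ϱ(x)⁻¹ (x₀v₀ + x₁v₁)` (`e_r = x_h / ϱ`, junk `0` on the axis). [folklore] -/
theorem inner_eR_left (x v : EuclideanSpace ℝ (Fin 3)) :
    ⟪eR x, v⟫ = (cylRadius x)⁻¹ * (x 0 * v 0 + x 1 * v 1) := by
  rw [eR, real_inner_smul_left, inner_horizontal_left]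

/-- **`ω_φ = ϱ⁻¹ (x₀ω₁ - x₁ω₀)`**: the angular vorticity is `ϱ⁻¹` times the swirl of the
vorticity, as an identity of functions on `ℝ³` (on the axis both sides vanish by their junk
values `e_θ = 0`, `0⁻¹ = 0`). [folklore] -/
theorem angularVorticity_eq_inv_mul_swirl
    (u : EuclideanSpace ℝ (Fin 3) → EuclideanSpace ℝ (Fin 3)) :
    angularVorticity u = fun y => (cylRadius y)⁻¹ * swirl (curl u) y := by
  funext y
  rw [angularVorticity_apply, eTheta, real_inner_smul_right, real_inner_comm,
    show (toLp 2 ![-y 1, y 0, 0] : EuclideanSpace ℝ (Fin 3)) = rotGen y from rfl,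
    ← congrFun (swirl_eq_inner_rotGen _) y]

/-- **`V_φ = ϱ⁻¹ Γ`**, `Γ = x₀V₁ - x₁V₀` the swirl, as an identity of functions on `ℝ³` (both
sides vanish on the axis). [folklore] -/
theorem swirlVelocity_eq_inv_mul_swirl (u : EuclideanSpace ℝ (Fin 3) → EuclideanSpace ℝ (Fin 3)) :
    swirlVelocity u = fun y => (cylRadius y)⁻¹ * swirl u y := by
  funext y
  rw [swirlVelocity, eTheta, real_inner_smul_right, real_inner_comm,
    show (toLp 2 ![-y 1, y 0, 0] : EuclideanSpace ℝ (Fin 3)) = rotGen y from rfl,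
    ← congrFun (swirl_eq_inner_rotGen _) y]

/-- `V_ϱ = ϱ⁻¹ ⟪x_h, V⟫`. [folklore] -/
theorem radialVelocity_eq_inv_mul_inner (u : EuclideanSpace ℝ (Fin 3) → EuclideanSpace ℝ (Fin 3))
    (x : EuclideanSpace ℝ (Fin 3)) :
    radialVelocity u x =
      (cylRadius x)⁻¹ * ⟪(toLp 2 ![x 0, x 1, 0] : EuclideanSpace ℝ (Fin 3)), u x⟫ := by
  rw [radialVelocity, real_inner_comm, inner_eR_left, inner_horizontal_left]

/-! ### Infinitesimal axisymmetry at a point and on a rotation-invariant open set -/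

/-- **Infinitesimal axisymmetry at a point**: if `u(R_θ x) = R_θ u(x)` for all rotations `R_θ`
about the axis (at the single point `x`) and `u` is differentiable at `x`, then
`Du(x)[Jx] = J u(x)` (differentiate in `θ` at `θ = 0`; pointwise form of the tree's
`IsAxisymmetric.fderiv_rotGen`). [folklore] -/
theorem fderiv_rotGen_of_forall_rotZ {u : EuclideanSpace ℝ (Fin 3) → EuclideanSpace ℝ (Fin 3)}
    {x : EuclideanSpace ℝ (Fin 3)}
    (hu : ∀ θ : ℝ, u (rotZ θ x) = rotZ θ (u x)) (hd : DifferentiableAt ℝ u x) :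
    fderiv ℝ u x (rotGen x) = rotGen (u x) := by
  have h1 : HasDerivAt (fun θ => u (rotZ θ x)) (fderiv ℝ u x (rotGen x)) 0 := by
    have hu' : HasFDerivAt u (fderiv ℝ u x) (rotZ 0 x) := by
      rw [rotZ_zero]
      exact hd.hasFDerivAt
    exact hu'.comp_hasDerivAt (0 : ℝ) (hasDerivAt_rotZ_zero x)
  have heq : (fun θ => u (rotZ θ x)) = fun θ => rotZ θ (u x) := funext fun θ => hu θ
  rw [heq] at h1
  exact h1.unique (hasDerivAt_rotZ_zero (u x))

/-- **Equivariance of the Jacobian on a rotation-invariant open set**: if `u` is differentiable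
on the open, rotation-invariant set `W` and `u(R_θ y) = R_θ u(y)` for all `θ` and all `y ∈ W`,
then `Du(R_θ x) = R_θ ∘ Du(x) ∘ R_{-θ}` for `x ∈ W` (local form of the tree's
`IsAxisymmetric.fderiv_rotZ`). [folklore] -/
theorem fderiv_rotZ_of_forall_mem {u : EuclideanSpace ℝ (Fin 3) → EuclideanSpace ℝ (Fin 3)}
    {W : Set (EuclideanSpace ℝ (Fin 3))} (hW : IsOpen W)
    (hWrot : ∀ θ : ℝ, ∀ y ∈ W, rotZ θ y ∈ W)
    (hu : ∀ θ : ℝ, ∀ y ∈ W, u (rotZ θ y) = rotZ θ (u y))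
    (hd : ∀ y ∈ W, DifferentiableAt ℝ u y) (θ : ℝ) {x : EuclideanSpace ℝ (Fin 3)} (hx : x ∈ W) :
    fderiv ℝ u (rotZ θ x) = (rotZL θ).comp ((fderiv ℝ u x).comp (rotZL (-θ))) := by
  have hl : HasFDerivAt (fun y => u (rotZL θ y)) ((fderiv ℝ u (rotZ θ x)).comp (rotZL θ)) x :=
    (hd _ (hWrot θ x hx)).hasFDerivAt.comp x (rotZL θ).hasFDerivAt
  have hr : HasFDerivAt (fun y => rotZL θ (u y)) ((rotZL θ).comp (fderiv ℝ u x)) x :=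
    (rotZL θ).hasFDerivAt.comp x (hd x hx).hasFDerivAt
  have hev : (fun y => u (rotZL θ y)) =ᶠ[𝓝 x] fun y => rotZL θ (u y) := by
    filter_upwards [hW.mem_nhds hx] with y hy
    exact hu θ y hy
  have heq := (hl.congr_of_eventuallyEq hev.symm).unique hr
  calc fderiv ℝ u (rotZ θ x)
      = ((fderiv ℝ u (rotZ θ x)).comp (rotZL θ)).comp (rotZL (-θ)) := by
          rw [ContinuousLinearMap.comp_assoc, rotZL_comp_neg, ContinuousLinearMap.comp_id]
    _ = ((rotZL θ).comp (fderiv ℝ u x)).comp (rotZL (-θ)) := by rw [heq]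
    _ = (rotZL θ).comp ((fderiv ℝ u x).comp (rotZL (-θ))) := by
          rw [ContinuousLinearMap.comp_assoc]

/-- **The vorticity of a locally axisymmetric field is axisymmetric**: under the hypotheses of
`fderiv_rotZ_of_forall_mem`, `curl u (R_θ x) = R_θ (curl u x)` for `x ∈ W`
(`curlvec (R A R⁻¹) = R (curlvec A)`, the tree's `curlCLM_rotZL_conj`). [folklore] -/
theorem curl_rotZ_of_forall_mem {u : EuclideanSpace ℝ (Fin 3) → EuclideanSpace ℝ (Fin 3)}
    {W : Set (EuclideanSpace ℝ (Fin 3))} (hW : IsOpen W)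
    (hWrot : ∀ θ : ℝ, ∀ y ∈ W, rotZ θ y ∈ W)
    (hu : ∀ θ : ℝ, ∀ y ∈ W, u (rotZ θ y) = rotZ θ (u y))
    (hd : ∀ y ∈ W, DifferentiableAt ℝ u y) (θ : ℝ) {x : EuclideanSpace ℝ (Fin 3)} (hx : x ∈ W) :
    curl u (rotZ θ x) = rotZ θ (curl u x) := by
  rw [curl_eq_curlCLM, curl_eq_curlCLM, fderiv_rotZ_of_forall_mem hW hWrot hu hd θ hx,
    curlCLM_rotZL_conj]

/-- **Horizontal derivative of the swirl from infinitesimal axisymmetry**: if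
`Du(x)[Jx] = J u(x)` then `DΓ(x)[x_h] = ϱ² (∂₀u₁ - ∂₁u₀)`, `Γ = swirl u` (pointwise form of the
tree's `IsAxisymmetric.fderiv_swirl_horizontal`). [folklore] -/
theorem fderiv_swirl_horizontal_of_fderiv_rotGen
    {u : EuclideanSpace ℝ (Fin 3) → EuclideanSpace ℝ (Fin 3)}
    {x : EuclideanSpace ℝ (Fin 3)}
    (hJ : fderiv ℝ u x (rotGen x) = rotGen (u x)) (hd : DifferentiableAt ℝ u x) :
    fderiv ℝ (swirl u) x (toLp 2 ![x 0, x 1, 0]) = cylRadius x ^ 2 *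
      (fderiv ℝ u x (EuclideanSpace.single 0 1) 1 -
        fderiv ℝ u x (EuclideanSpace.single 1 1) 0) := by
  rw [rotGen_eq_sub_single, map_sub, map_smul, map_smul] at hJ
  have hA := congrArg (fun v : EuclideanSpace ℝ (Fin 3) => v 0) hJ
  have hB := congrArg (fun v : EuclideanSpace ℝ (Fin 3) => v 1) hJ
  simp only [PiLp.sub_apply, PiLp.smul_apply, smul_eq_mul, rotGen_apply_zero,
    rotGen_apply_one] at hA hB
  rw [fderiv_swirl_apply hd, toLp_horizontal_eq_add_single, map_add, map_smul, map_smul,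
    rotGen_add, rotGen_smul, rotGen_smul, rotGen_single_zero, rotGen_single_one,
    inner_rotGen_left, cylRadius_sq]
  simp only [PiLp.add_apply, PiLp.smul_apply, smul_eq_mul, inner_add_left, inner_smul_left,
    inner_neg_left, EuclideanSpace.inner_single_left, map_one, one_mul, RCLike.conj_to_real]
  linear_combination x 0 * hA + x 1 * hB

/-- **Radial derivative of the swirl from infinitesimal axisymmetry**: `∂_{e_r}Γ(x) =
ϱ (∂₀u₁ - ∂₁u₀)` off the axis. [folklore] -/
theorem fderiv_swirl_eR_of_fderiv_rotGen {u : EuclideanSpace ℝ (Fin 3) → EuclideanSpace ℝ (Fin 3)}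
    {x : EuclideanSpace ℝ (Fin 3)}
    (hJ : fderiv ℝ u x (rotGen x) = rotGen (u x)) (hd : DifferentiableAt ℝ u x)
    (hx : cylRadius x ≠ 0) :
    fderiv ℝ (swirl u) x (eR x) = cylRadius x *
      (fderiv ℝ u x (EuclideanSpace.single 0 1) 1 -
        fderiv ℝ u x (EuclideanSpace.single 1 1) 0) := by
  rw [eR, map_smul, fderiv_swirl_horizontal_of_fderiv_rotGen hJ hd, smul_eq_mul, ← mul_assoc,
    pow_two, ← mul_assoc, inv_mul_cancel₀ hx, one_mul]

/-! ### Calculus of `ϱ⁻¹`: first derivatives and the Laplacian `Δ(ϱ⁻¹) = ϱ⁻³` -/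

/-- The derivative of `ϱ⁻¹` off the axis: `D(ϱ⁻¹)(x) = -ϱ⁻² ⟪e_r(x), ·⟫`. [folklore] -/
theorem hasFDerivAt_inv_cylRadius {x : EuclideanSpace ℝ (Fin 3)} (hx : cylRadius x ≠ 0) :
    HasFDerivAt (fun y : EuclideanSpace ℝ (Fin 3) => (cylRadius y)⁻¹)
      ((-(cylRadius x ^ 2)⁻¹) • (innerSL ℝ (eR x))) x := by
  have h := (hasFDerivAt_inv hx).comp x (hasFDerivAt_cylRadius hx)
  refine h.congr_fderiv ?_
  ext v
  simp only [ContinuousLinearMap.comp_apply, ContinuousLinearMap.toSpanSingleton_apply,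
    _root_.smul_apply, smul_eq_mul, innerSL_apply_apply]
  ring

/-- The derivative of `ϱ⁻³` off the axis: `D(ϱ⁻³)(x) = -3ϱ⁻⁴ ⟪e_r(x), ·⟫`. [folklore] -/
theorem hasFDerivAt_inv_cylRadius_pow_three {x : EuclideanSpace ℝ (Fin 3)} (hx : cylRadius x ≠ 0) :
    HasFDerivAt (fun y : EuclideanSpace ℝ (Fin 3) => (cylRadius y ^ 3)⁻¹)
      ((-3 * (cylRadius x ^ 4)⁻¹) • (innerSL ℝ (eR x))) x := by
  have h := (hasFDerivAt_inv (pow_ne_zero 3 hx)).comp x ((hasFDerivAt_cylRadius hx).pow 3)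
  refine h.congr_fderiv ?_
  ext v
  simp only [ContinuousLinearMap.comp_apply, ContinuousLinearMap.toSpanSingleton_apply,
    _root_.smul_apply, smul_eq_mul, innerSL_apply_apply, nsmul_eq_mul, Nat.cast_ofNat]
  field_simp
  ring

/-- Directional derivatives of `ϱ⁻¹` off the axis: `∂ₐ(ϱ⁻¹)(y) = -(y₀a₀ + y₁a₁) ϱ(y)⁻³`.
[folklore] -/
theorem fderiv_inv_cylRadius_apply {y : EuclideanSpace ℝ (Fin 3)} (hy : cylRadius y ≠ 0)
    (a : EuclideanSpace ℝ (Fin 3)) :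
    fderiv ℝ (fun z : EuclideanSpace ℝ (Fin 3) => (cylRadius z)⁻¹) y a =
      -(y 0 * a 0 + y 1 * a 1) * (cylRadius y ^ 3)⁻¹ := by
  rw [(hasFDerivAt_inv_cylRadius hy).fderiv, _root_.smul_apply, innerSL_apply_apply,
    inner_eR_left, smul_eq_mul]
  field_simp

/-- **`Δ(ϱ⁻¹) = ϱ⁻³` off the axis** (the function `ϱ⁻¹ = (x₀² + x₁²)^{-1/2}` depends on two of
the three variables; `∂ₐ∂ₐ(ϱ⁻¹) = 3(x₀a₀ + x₁a₁)²ϱ⁻⁵ - (a₀² + a₁²)ϱ⁻³`, summed over the standard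
basis). [folklore] -/
theorem laplacian_inv_cylRadius {x : EuclideanSpace ℝ (Fin 3)} (hx : cylRadius x ≠ 0) :
    (Δ fun y : EuclideanSpace ℝ (Fin 3) => (cylRadius y)⁻¹) x = (cylRadius x ^ 3)⁻¹ := by
  set f : EuclideanSpace ℝ (Fin 3) → ℝ := fun y => (cylRadius y)⁻¹
  set b := EuclideanSpace.basisFun (Fin 3) ℝ with hb
  have hb' : ∀ i, b i = EuclideanSpace.single i 1 := fun i => by simp [hb]
  -- `f` is smooth at `x`, so `fderiv f` is differentiable at `x`
  have hfx : ContDiffAt ℝ 2 f x := (contDiffAt_cylRadius hx).inv hx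
  have hD : DifferentiableAt ℝ (fderiv ℝ f) x :=
    (hfx.fderiv_right (m := 1) le_rfl).differentiableAt one_ne_zero
  -- the directional derivatives near `x`
  have hU : ∀ᶠ y in 𝓝 x, cylRadius y ≠ 0 :=
    (isOpen_ne_fun continuous_cylRadius continuous_const).mem_nhds hx
  have hdir : ∀ a : EuclideanSpace ℝ (Fin 3), (fun y => fderiv ℝ f y a) =ᶠ[𝓝 x]
      fun y => -(y 0 * a 0 + y 1 * a 1) * (cylRadius y ^ 3)⁻¹ := fun a => by
    filter_upwards [hU] with y hy
    exact fderiv_inv_cylRadius_apply hy a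
  -- second directional derivatives at `x`
  have hsec : ∀ a : EuclideanSpace ℝ (Fin 3), fderiv ℝ (fun y => fderiv ℝ f y a) x a =
      3 * (x 0 * a 0 + x 1 * a 1) ^ 2 * (cylRadius x ^ 5)⁻¹ -
        (a 0 ^ 2 + a 1 ^ 2) * (cylRadius x ^ 3)⁻¹ := by
    intro a
    rw [(hdir a).fderiv_eq]
    have hℓ : HasFDerivAt (fun y : EuclideanSpace ℝ (Fin 3) => -(y 0 * a 0 + y 1 * a 1))
        (-((a 0) • (EuclideanSpace.proj (𝕜 := ℝ) (0 : Fin 3)) +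
          (a 1) • (EuclideanSpace.proj (𝕜 := ℝ) (1 : Fin 3)))) x :=
      ((((EuclideanSpace.proj (𝕜 := ℝ) (0 : Fin 3)).hasFDerivAt.mul_const (a 0)).add
        ((EuclideanSpace.proj (𝕜 := ℝ) (1 : Fin 3)).hasFDerivAt.mul_const (a 1))).neg)
    have hF : HasFDerivAt
        (fun y : EuclideanSpace ℝ (Fin 3) => -(y 0 * a 0 + y 1 * a 1) * (cylRadius y ^ 3)⁻¹)
        (-(x 0 * a 0 + x 1 * a 1) • ((-3 * (cylRadius x ^ 4)⁻¹) • (innerSL ℝ (eR x))) +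
          (cylRadius x ^ 3)⁻¹ • -((a 0) • (EuclideanSpace.proj (𝕜 := ℝ) (0 : Fin 3)) +
            (a 1) • (EuclideanSpace.proj (𝕜 := ℝ) (1 : Fin 3)))) x :=
      hℓ.mul (hasFDerivAt_inv_cylRadius_pow_three hx)
    rw [hF.fderiv]
    simp only [_root_.add_apply, _root_.smul_apply, _root_.neg_apply, PiLp.proj_apply,
      innerSL_apply_apply, smul_eq_mul, inner_eR_left]
    field_simp
    ring
  -- assemble the Laplacian over the standard basis
  rw [InnerProductSpace.laplacian_eq_iteratedFDeriv_orthonormalBasis f b]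
  have h1 : ∀ i, iteratedFDeriv ℝ 2 f x ![b i, b i] =
      fderiv ℝ (fun y => fderiv ℝ f y (b i)) x (b i) := fun i => by
    rw [iteratedFDeriv_two_apply, fderiv_clm_apply hD (differentiableAt_const _)]
    simp
  simp only [Fin.sum_univ_three, h1, hsec]
  simp +decide only [hb', PiLp.single_apply, if_true, if_false]
  norm_num
  have hρ : x 0 ^ 2 + x 1 ^ 2 = cylRadius x ^ 2 := (cylRadius_sq x).symm
  field_simp
  linear_combination (3 : ℝ) * hρ

/-! ### The gradient and the Laplacian of `ω_φ = ϱ⁻¹ η`, `η = ⟪Jx, ω⟫` -/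

/-- **The derivative of the angular vorticity off the axis**: with `η = swirl (curl u)` and
`ω_φ = ϱ⁻¹ η` (`angularVorticity_eq_inv_mul_swirl`),
`Dω_φ(x) = ϱ⁻¹ Dη(x) - η(x) ϱ⁻² ⟪e_r(x), ·⟫`. [folklore] -/
theorem hasFDerivAt_angularVorticity {u : EuclideanSpace ℝ (Fin 3) → EuclideanSpace ℝ (Fin 3)}
    {x : EuclideanSpace ℝ (Fin 3)} (hρ : cylRadius x ≠ 0)
    (hω : DifferentiableAt ℝ (curl u) x) :
    HasFDerivAt (angularVorticity u)
      ((cylRadius x)⁻¹ • fderiv ℝ (swirl (curl u)) x +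
        swirl (curl u) x • ((-(cylRadius x ^ 2)⁻¹) • (innerSL ℝ (eR x)))) x := by
  rw [angularVorticity_eq_inv_mul_swirl]
  exact (hasFDerivAt_inv_cylRadius hρ).mul (differentiableAt_swirl hω).hasFDerivAt

/-- The directional derivatives of the angular vorticity off the axis:
`Dω_φ(x)[v] = ϱ⁻¹ Dη(x)[v] - η(x) ϱ⁻² ⟪e_r(x), v⟫`. [folklore] -/
theorem fderiv_angularVorticity_apply {u : EuclideanSpace ℝ (Fin 3) → EuclideanSpace ℝ (Fin 3)}
    {x : EuclideanSpace ℝ (Fin 3)} (hρ : cylRadius x ≠ 0)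
    (hω : DifferentiableAt ℝ (curl u) x) (v : EuclideanSpace ℝ (Fin 3)) :
    fderiv ℝ (angularVorticity u) x v = (cylRadius x)⁻¹ * fderiv ℝ (swirl (curl u)) x v -
      swirl (curl u) x * (cylRadius x ^ 2)⁻¹ * ⟪eR x, v⟫ := by
  rw [(hasFDerivAt_angularVorticity hρ hω).fderiv]
  simp only [_root_.add_apply, _root_.smul_apply, innerSL_apply_apply, smul_eq_mul]
  ring

/-- **The Laplacian of the angular vorticity off the axis.** Let `u` be of class `C³` on an open
set `W ∋ x` with `ϱ(x) ≠ 0`, `ω = curl u`, `η = swirl ω = x₀ω₁ - x₁ω₀`. Then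
`Δω_φ(x) = ϱ⁻¹ (⟪Jx, Δω(x)⟫ + 2(∂₀ω₁ - ∂₁ω₀)(x)) - 2ϱ⁻² ∂_{e_r}η(x) + ϱ⁻³ η(x)`
(Leibniz rule for `Δ(ϱ⁻¹ η)` — the tree's `laplacian_mul_eq` applied to global `C²`
representatives of `ϱ⁻¹` and `ω` near `x` —, `Δη = ⟪Jx, Δω⟫ + 2(∂₀ω₁ - ∂₁ω₀)` (the tree's
`laplacian_swirl`), `∇(ϱ⁻¹) = -ϱ⁻² e_r` and `Δ(ϱ⁻¹) = ϱ⁻³`). [folklore] -/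
theorem laplacian_angularVorticity {u : EuclideanSpace ℝ (Fin 3) → EuclideanSpace ℝ (Fin 3)}
    {W : Set (EuclideanSpace ℝ (Fin 3))} (hW : IsOpen W)
    (hu : ContDiffOn ℝ 3 u W) {x : EuclideanSpace ℝ (Fin 3)} (hx : x ∈ W) (hρ : cylRadius x ≠ 0) :
    (Δ (angularVorticity u)) x =
      (cylRadius x)⁻¹ * (⟪rotGen x, (Δ (curl u)) x⟫ +
          2 * (fderiv ℝ (curl u) x (EuclideanSpace.single 0 1) 1 -
            fderiv ℝ (curl u) x (EuclideanSpace.single 1 1) 0)) -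
        2 * (cylRadius x ^ 2)⁻¹ * fderiv ℝ (swirl (curl u)) x (eR x) +
        (cylRadius x ^ 3)⁻¹ * swirl (curl u) x := by
  -- global `C²` representatives of `ω = curl u` and of `ϱ⁻¹` near `x`
  have hω : ContDiffOn ℝ 2 (curl u) W := contDiffOn_curl_two hu hW
  obtain ⟨ω', hω', N, hN, hxN, -, hωN⟩ := ContDiffOn.exists_contDiff_eqOn_nhds_of_isCompact
    hω hW isCompact_singleton (singleton_subset_iff.2 hx)
  have hA : IsOpen {y : EuclideanSpace ℝ (Fin 3) | cylRadius y ≠ 0} :=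
    isOpen_ne_fun continuous_cylRadius continuous_const
  have hr : ContDiffOn ℝ 2 (fun y : EuclideanSpace ℝ (Fin 3) => (cylRadius y)⁻¹)
      {y | cylRadius y ≠ 0} :=
    fun y hy => ((contDiffAt_cylRadius hy).inv hy).contDiffWithinAt
  obtain ⟨r', hr', N', hN', hxN', -, hrN'⟩ := ContDiffOn.exists_contDiff_eqOn_nhds_of_isCompact
    hr hA isCompact_singleton (singleton_subset_iff.2 hρ)
  rw [singleton_subset_iff] at hxN hxN'
  have hNx : N ∈ 𝓝 x := hN.mem_nhds hxN
  have hN'x : N' ∈ 𝓝 x := hN'.mem_nhds hxN'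
  -- the agreements near `x`
  have e1 : angularVorticity u =ᶠ[𝓝 x] fun y => r' y * swirl ω' y := by
    rw [angularVorticity_eq_inv_mul_swirl]
    filter_upwards [hNx, hN'x] with y hy hy'
    rw [hrN' hy', swirl, swirl, hωN hy]
  have e2 : swirl ω' =ᶠ[𝓝 x] swirl (curl u) := by
    filter_upwards [hNx] with y hy
    rw [swirl, swirl, hωN hy]
  have e3 : ω' =ᶠ[𝓝 x] curl u := by
    filter_upwards [hNx] with y hy
    exact hωN hy
  have e4 : r' =ᶠ[𝓝 x] fun y => (cylRadius y)⁻¹ := by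
    filter_upwards [hN'x] with y hy
    exact hrN' hy
  -- the Leibniz rule for the representatives
  set b := EuclideanSpace.basisFun (Fin 3) ℝ
  rw [(InnerProductSpace.laplacian_congr_nhds e1).eq_of_nhds,
    laplacian_mul_eq b hr' (contDiff_swirl hω') x]
  -- identification of the pieces
  have p1 : r' x = (cylRadius x)⁻¹ := e4.eq_of_nhds
  have p2 : (Δ r') x = (cylRadius x ^ 3)⁻¹ := by
    rw [(InnerProductSpace.laplacian_congr_nhds e4).eq_of_nhds, laplacian_inv_cylRadius hρ]
  have p3 : ∀ a, fderiv ℝ r' x a = -(cylRadius x ^ 2)⁻¹ * ⟪eR x, a⟫ := fun a => by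
    rw [e4.fderiv_eq, (hasFDerivAt_inv_cylRadius hρ).fderiv, _root_.smul_apply,
      innerSL_apply_apply, smul_eq_mul]
  have p4 : swirl ω' x = swirl (curl u) x := e2.eq_of_nhds
  have p5 : fderiv ℝ (swirl ω') x = fderiv ℝ (swirl (curl u)) x := e2.fderiv_eq
  have p6 : (Δ (swirl ω')) x = ⟪rotGen x, (Δ (curl u)) x⟫ +
      2 * (fderiv ℝ (curl u) x (EuclideanSpace.single 0 1) 1 -
        fderiv ℝ (curl u) x (EuclideanSpace.single 1 1) 0) := by
    rw [laplacian_swirl hω' x, (InnerProductSpace.laplacian_congr_nhds e3).eq_of_nhds,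
      e3.fderiv_eq]
  -- the cross term `Σᵢ ∂ᵢ(ϱ⁻¹) ∂ᵢη = -ϱ⁻² ∂_{e_r}η`
  have p7 : ∑ i, fderiv ℝ r' x (b i) * fderiv ℝ (swirl ω') x (b i) =
      -(cylRadius x ^ 2)⁻¹ * fderiv ℝ (swirl (curl u)) x (eR x) := by
    simp_rw [p3, p5]
    have h : ∑ i, -(cylRadius x ^ 2)⁻¹ * ⟪eR x, b i⟫ * fderiv ℝ (swirl (curl u)) x (b i) =
        -(cylRadius x ^ 2)⁻¹ * fderiv ℝ (swirl (curl u)) x (∑ i, ⟪b i, eR x⟫ • b i) := by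
      rw [map_sum, Finset.mul_sum]
      refine Finset.sum_congr rfl fun i _ => ?_
      rw [map_smul, smul_eq_mul, real_inner_comm]
      ring
    rw [h, b.sum_repr']
  rw [p1, p2, p4, p6, p7]
  ring

/-! ### The pointwise identity: the `e_φ`-component of the vorticity equation in cylindrical form -/

/-- **The `e_φ`-component of `Δω - (u·∇)ω + (ω·∇)u`, in cylindrical form.** Let `u` be of
class `C³` on an open set `W ∋ x` off the axis, infinitesimally axisymmetric at `x` together
with its vorticity (`Du(x)[Jx] = Ju(x)`, `Dω(x)[Jx] = Jω(x)`, `ω = curl u`; both hold for fields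
axially symmetric near `x`). Then, with `ω_φ = angularVorticity u`, `u_ϱ = radialVelocity u`,
`u_φ = swirlVelocity u` and `∂₃u_φ = D(u_φ)(e₃)`,
`ϱ⁻¹⟪Jx, Δω - Dω[u] + Du[ω]⟫ + Dω_φ[u] - u_ϱ ω_φ/ϱ - Δω_φ + ω_φ/ϱ² = (2/ϱ) u_φ ∂₃u_φ` at `x`.
Ingredients: `⟪Jx, Δω⟫ = Δη - 2(∂₀ω₁ - ∂₁ω₀) = Δη - (2/ϱ)∂_{e_r}η` (`laplacian_swirl` and the
infinitesimal axisymmetry of `ω`), `⟪Jx, Dω[u]⟫ = Dη[u] - ⟪Ju, ω⟫`, `⟪Jx, Du[ω]⟫ = ⟪ω, Du(Jx)⟫ =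
⟪ω, Ju⟫`, Lagrange's identity `ϱ²⟪Ju, ω⟫ = ⟪x_h, u⟫η - Γ⟪x_h, ω⟫` with
`⟪x_h, ω⟫ = -∂₃Γ` (`ω_r = -∂₃u_φ`), `Γ = ϱ u_φ`, and the formulas for `Dω_φ`, `Δω_φ` of
`ω_φ = ϱ⁻¹η` (Seregin–Zajaczkowski 2007, (4.5) is `∂ₜω_φ` equal to this combination;
Majda–Bertozzi, *Vorticity and incompressible flow*, §2.3.3).
[cite: SereginZajaczkowski2007, proof of Lemma 4.2, (4.5)] -/
theorem inv_cylRadius_mul_inner_rotGen_vorticityRHS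
    {u : EuclideanSpace ℝ (Fin 3) → EuclideanSpace ℝ (Fin 3)}
    {W : Set (EuclideanSpace ℝ (Fin 3))} (hW : IsOpen W)
    (hu : ContDiffOn ℝ 3 u W) {x : EuclideanSpace ℝ (Fin 3)} (hx : x ∈ W) (hρ : cylRadius x ≠ 0)
    (hJu : fderiv ℝ u x (rotGen x) = rotGen (u x))
    (hJω : fderiv ℝ (curl u) x (rotGen x) = rotGen (curl u x)) :
    (cylRadius x)⁻¹ * ⟪rotGen x, (Δ (curl u)) x - fderiv ℝ (curl u) x (u x) +
          fderiv ℝ u x (curl u x)⟫ +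
        fderiv ℝ (angularVorticity u) x (u x) -
        radialVelocity u x * angularVorticity u x / cylRadius x -
        (Δ (angularVorticity u)) x + angularVorticity u x / cylRadius x ^ 2 =
      2 / cylRadius x * swirlVelocity u x * fderiv ℝ (swirlVelocity u) x eZ := by
  -- differentiability at `x`
  have hxW : W ∈ 𝓝 x := hW.mem_nhds hx
  have hud : DifferentiableAt ℝ u x := (hu.differentiableOn (by norm_num)).differentiableAt hxW
  have hωd : DifferentiableAt ℝ (curl u) x :=
    ((contDiffOn_curl_two hu hW).differentiableOn (by norm_num)).differentiableAt hxW
  -- the sub-identities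
  have hΔ := laplacian_angularVorticity hW hu hx hρ
  have hB : fderiv ℝ (swirl (curl u)) x (eR x) = cylRadius x *
      (fderiv ℝ (curl u) x (EuclideanSpace.single 0 1) 1 -
        fderiv ℝ (curl u) x (EuclideanSpace.single 1 1) 0) :=
    fderiv_swirl_eR_of_fderiv_rotGen hJω hωd hρ
  have hC : ⟪rotGen x, fderiv ℝ (curl u) x (u x)⟫ =
      fderiv ℝ (swirl (curl u)) x (u x) - ⟪rotGen (u x), curl u x⟫ := by
    rw [fderiv_swirl_apply hωd]
    ring
  have hD : ⟪rotGen x, fderiv ℝ u x (curl u x)⟫ = ⟪rotGen (u x), curl u x⟫ := by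
    rw [curl_eq_curlCLM, ← real_inner_comm, inner_apply_curlCLM, hJu, real_inner_comm]
  have hE := cylRadius_sq_mul_inner_rotGen x (u x) (curl u x)
  have hF : ⟪(toLp 2 ![x 0, x 1, 0] : EuclideanSpace ℝ (Fin 3)), curl u x⟫ =
      -fderiv ℝ (swirl u) x eZ := by
    rw [real_inner_comm, inner_curl_horizontal, hJu, rotGen_apply_two, zero_sub,
      fderiv_swirl_apply hud, eZ, rotGen_single_two, inner_zero_left, add_zero]
  have hH1 : swirlVelocity u x = (cylRadius x)⁻¹ * swirl u x := by
    rw [swirlVelocity_eq_inv_mul_swirl]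
  have hH2 : fderiv ℝ (swirlVelocity u) x eZ = (cylRadius x)⁻¹ * fderiv ℝ (swirl u) x eZ := by
    have h : HasFDerivAt (fun y => (cylRadius y)⁻¹ * swirl u y)
        ((cylRadius x)⁻¹ • fderiv ℝ (swirl u) x +
          swirl u x • ((-(cylRadius x ^ 2)⁻¹) • (innerSL ℝ (eR x)))) x :=
      (hasFDerivAt_inv_cylRadius hρ).mul (differentiableAt_swirl hud).hasFDerivAt
    rw [swirlVelocity_eq_inv_mul_swirl, h.fderiv]
    simp only [_root_.add_apply, _root_.smul_apply, innerSL_apply_apply, smul_eq_mul,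
      inner_eR_eZ, mul_zero, add_zero]
  have hI := radialVelocity_eq_inv_mul_inner u x
  have hJ1 : angularVorticity u x = (cylRadius x)⁻¹ * swirl (curl u) x := by
    rw [angularVorticity_eq_inv_mul_swirl]
  have hJ2 := fderiv_angularVorticity_apply hρ hωd (u x)
  have hJ3 : ⟪eR x, u x⟫ =
      (cylRadius x)⁻¹ * ⟪(toLp 2 ![x 0, x 1, 0] : EuclideanSpace ℝ (Fin 3)), u x⟫ := by
    rw [inner_eR_left, inner_horizontal_left]
  -- the pairings are the swirls
  have hη : swirl (curl u) x = ⟪rotGen x, curl u x⟫ := by rw [swirl_eq_inner_rotGen]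
  have hΓ : swirl u x = ⟪rotGen x, u x⟫ := by rw [swirl_eq_inner_rotGen]
  rw [hF, ← hη, ← hΓ] at hE
  -- assemble
  rw [inner_add_right, inner_sub_right, hC, hD, hJ2, hJ3, hI, hJ1, hΔ, hB, hH1, hH2]
  field_simp
  linear_combination (2 : ℝ) * hE

/-! ### The discharge: (4.5) holds classically for the class of Proposition 4.1 -/

/-- `e_r` is continuous off the axis. [folklore] -/
theorem continuousOn_eR : ContinuousOn eR {y : EuclideanSpace ℝ (Fin 3) | cylRadius y ≠ 0} := by
  have h : Continuous fun y : EuclideanSpace ℝ (Fin 3) =>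
      (toLp 2 ![y 0, y 1, 0] : EuclideanSpace ℝ (Fin 3)) := by
    have e : (fun y : EuclideanSpace ℝ (Fin 3) =>
        (toLp 2 ![y 0, y 1, 0] : EuclideanSpace ℝ (Fin 3))) =
        fun y => y 0 • EuclideanSpace.single 0 (1 : ℝ) + y 1 • EuclideanSpace.single 1 (1 : ℝ) :=
      funext fun y => toLp_horizontal_eq_add_single y
    rw [e]
    exact (((EuclideanSpace.proj (𝕜 := ℝ) (0 : Fin 3)).continuous.smul continuous_const).add
      ((EuclideanSpace.proj (𝕜 := ℝ) (1 : Fin 3)).continuous.smul continuous_const))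
  exact (continuous_cylRadius.continuousOn.inv₀ fun y hy => hy).smul h.continuousOn

/-- **Seregin–Zajaczkowski 2007, the equation (4.5) for `χ = ω_φ`, proved** for the class of
Proposition 4.1 (`AngularVorticityEquation`). For `(V, P)` in
`IsSmoothAxisymmetricSolutionOn Q̃ V P` — a suitable weak (in particular distributional) solution
of the Navier–Stokes system on `Q̃ = ]-2², 0[ × 𝒞(1/4, 3; 2)`, axially symmetric, with `C^∞`
slices whose spatial Taylor coefficients are jointly continuous on `Q̃` —:

1. the vorticity `ω = curl V` is jointly `C¹` on `Q̃` and satisfies the vorticity equation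
   `∂ₜω = Δω - (V·∇)ω + (ω·∇)V` with a classical time derivative at every point of `Q̃` (the
   tree's `vorticity_classical_of_isDistributionalNSSolutionOn`: the momentum equation tested
   with curls of test fields, slicewise integration by parts, du Bois-Reymond in time);
2. `ω_φ = ϱ⁻¹⟪Jx, ω⟫`, so `∂ₜω_φ = ϱ⁻¹⟪Jx, Δω - (V·∇)ω + (ω·∇)V⟫`, and the `e_φ`-component of
   the right-hand side is put in the cylindrical form (4.5) by
   `inv_cylRadius_mul_inner_rotGen_vorticityRHS`, using the infinitesimal axisymmetry
   `DV[Jx] = JV`, `Dω[Jx] = Jω` of the slices at the points of `Q̃` (the slices are axially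
   symmetric on the rotation-invariant shell, `curl_rotZ_of_forall_mem`);
3. the regularity recorded in `AngularVorticityEqOn` follows from the joint `C¹` regularity of
   `(t, x) ↦ ω_φ = ϱ⁻¹⟪Jx, ω(t, x)⟫` on `Q̃` (continuity of `ω_φ`, `D_xω_φ`, `∂ₜω_φ`), from the
   smoothness of the slices (`ω_φ(t, ·)` is `C²`), and from the formula of
   `laplacian_angularVorticity` together with the joint continuity of `ω`, `D_xω`, `Δ_xω`.
[cite: SereginZajaczkowski2007, proof of Lemma 4.2, (4.3)–(4.5)] -/
theorem AngularVorticityEquation_holds : AngularVorticityEquation := by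
  intro V P hV
  -- `Q̃ = I × S`
  set I : Set ℝ := Ioo (-(2 : ℝ) ^ 2) 0
  set S : Set (EuclideanSpace ℝ (Fin 3)) := shell (1 / 4) 3 2 with hSdef
  have hIo : IsOpen I := isOpen_Ioo
  have hSo : IsOpen S := isOpen_shell _ _ _
  set O : Set (ℝ × EuclideanSpace ℝ (Fin 3)) := I ×ˢ S
  have hOo : IsOpen O := hIo.prod hSo
  have hOpens : shellCylOpens (1 / 4) 3 2 2 = (⟨O, hOo⟩ : Opens (ℝ × EuclideanSpace ℝ (Fin 3))) :=
    rfl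
  have hSρ : ∀ y ∈ S, cylRadius y ≠ 0 := fun y hy => by
    rw [hSdef, mem_shell] at hy
    exact (lt_trans (by norm_num) hy.1.1).ne'
  have hSrot : ∀ θ : ℝ, ∀ y ∈ S, rotZ θ y ∈ S := fun θ y hy => (rotZ_mem_shell_iff θ).2 hy
  -- Step 1: the classical vorticity equation for the class (tree)
  have hsol :
      IsDistributionalNSSolutionOn (⟨O, hOo⟩ : Opens (ℝ × EuclideanSpace ℝ (Fin 3))) 1 0 V P := by
    have h := hV.suitable.distributional
    rwa [hOpens] at h
  have hU3 : ∀ t ∈ I, ContDiffOn ℝ 3 (V t) S := fun t ht y hy =>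
    ((hV.contDiffAt (t, y) ⟨ht, hy⟩).of_le
      (ENat.natCast_le_of_coe_top_le_withTop le_rfl 3)).contDiffWithinAt
  have hΦ : ∀ n ≤ 3,
      ContinuousOn (fun w : ℝ × EuclideanSpace ℝ (Fin 3) => iteratedFDeriv ℝ n (V w.1) w.2) O :=
    fun n _ => hV.continuousOn_iteratedFDeriv n
  obtain ⟨-, -, hderiv, -, hC1⟩ :=
    vorticity_classical_of_isDistributionalNSSolutionOn hIo hSo hsol hU3 hΦ
  simp only [vorticity_apply, one_smul, convect_apply] at hderiv
  -- joint continuity of `ω`, `D_xω`, `Δ_xω` on `Q̃`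
  have hGn : ∀ n ≤ 2, ContinuousOn
      (fun w : ℝ × EuclideanSpace ℝ (Fin 3) =>
        iteratedFDeriv ℝ n (fun y => fderiv ℝ (V w.1) y) w.2) O :=
    fun n hn => continuousOn_iteratedFDeriv_fderiv_of_succ (hΦ (n + 1) (by omega))
  have hGd : ∀ n : ℕ, n ≤ 2 → ∀ w ∈ O, ContDiffAt ℝ n (fun y => fderiv ℝ (V w.1) y) w.2 := by
    intro n hn w hw
    have h3 : ContDiffAt ℝ 3 (V w.1) w.2 := (hU3 w.1 hw.1).contDiffAt (hSo.mem_nhds hw.2)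
    have h2 : ContDiffAt ℝ 2 (fderiv ℝ (V w.1)) w.2 := h3.fderiv_right (by norm_cast)
    exact h2.of_le (by exact_mod_cast hn)
  have hωn : ∀ n ≤ 2,
      ContinuousOn (fun w : ℝ × EuclideanSpace ℝ (Fin 3) => iteratedFDeriv ℝ n (curl (V w.1)) w.2)
        O := by
    intro n hn
    have h := continuousOn_iteratedFDeriv_clm_comp (O := O) (H := fun t y => fderiv ℝ (V t) y)
      curlCLM (hGn n hn) (hGd n hn)
    have e : (fun w : ℝ × EuclideanSpace ℝ (Fin 3) => iteratedFDeriv ℝ n (curl (V w.1)) w.2) =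
        fun w : ℝ × EuclideanSpace ℝ (Fin 3) =>
          iteratedFDeriv ℝ n (fun y => curlCLM (fderiv ℝ (V w.1) y)) w.2 := by
      funext w
      rfl
    rw [e]
    exact h
  have hω0 : ContinuousOn (fun w : ℝ × EuclideanSpace ℝ (Fin 3) => curl (V w.1) w.2) O :=
    continuousOn_uncurry_of_continuousOn_iteratedFDeriv_zero (H := fun t y => curl (V t) y)
      (hωn 0 (by norm_num))
  have hDω : ContinuousOn (fun w : ℝ × EuclideanSpace ℝ (Fin 3) => fderiv ℝ (curl (V w.1)) w.2) O :=
    continuousOn_fderiv_of_continuousOn_iteratedFDeriv_one (H := fun t y => curl (V t) y)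
      (hωn 1 (by norm_num))
  have hΔω : ContinuousOn (fun w : ℝ × EuclideanSpace ℝ (Fin 3) => (Δ (curl (V w.1))) w.2) O :=
    continuousOn_laplacian_of_continuousOn_iteratedFDeriv_two (H := fun t y => curl (V t) y)
      (hωn 2 le_rfl)
  -- differentiability and infinitesimal axisymmetry of the slices and their vorticities
  have hωd : ∀ z ∈ O, DifferentiableAt ℝ (curl (V z.1)) z.2 := fun z hz =>
    ((contDiffOn_curl_two (hU3 z.1 hz.1) hSo).differentiableOn (by norm_num)).differentiableAt
      (hSo.mem_nhds hz.2)
  have hJu : ∀ z ∈ O, fderiv ℝ (V z.1) z.2 (rotGen z.2) = rotGen (V z.1 z.2) := fun z hz =>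
    fderiv_rotGen_of_forall_rotZ (fun θ => hV.axisymmetric θ z hz) (hV.differentiableAt hz)
  have hJω : ∀ z ∈ O, fderiv ℝ (curl (V z.1)) z.2 (rotGen z.2) = rotGen (curl (V z.1) z.2) := by
    intro z hz
    refine fderiv_rotGen_of_forall_rotZ (fun θ => ?_) (hωd z hz)
    exact curl_rotZ_of_forall_mem hSo hSrot (fun θ y hy => hV.axisymmetric θ (z.1, y) ⟨hz.1, hy⟩)
      (fun y hy => hV.differentiableAt (z := (z.1, y)) ⟨hz.1, hy⟩) θ hz.2
  -- the time derivative of `ω_φ = ϱ⁻¹ ⟪Jx, ω⟫`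
  have hχfun : ∀ x : EuclideanSpace ℝ (Fin 3), (fun s => angularVorticity (V s) x) =
      fun s => (cylRadius x)⁻¹ * ⟪rotGen x, curl (V s) x⟫ := fun x => by
    funext s
    rw [angularVorticity_eq_inv_mul_swirl, swirl_eq_inner_rotGen]
  have hχt : ∀ t ∈ I, ∀ x ∈ S, HasDerivAt (fun s => angularVorticity (V s) x)
      ((cylRadius x)⁻¹ * ⟪rotGen x, (Δ (curl (V t))) x - fderiv ℝ (curl (V t)) x (V t x) +
        fderiv ℝ (V t) x (curl (V t) x)⟫) t := by
    intro t ht x hx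
    rw [hχfun x]
    have h := ((innerSL ℝ (rotGen x)).hasFDerivAt.comp_hasDerivAt t
      (hderiv t ht x hx)).const_mul ((cylRadius x)⁻¹)
    simpa only [Function.comp_def, innerSL_apply_apply] using h
  -- the joint `C¹` regularity of `(t, x) ↦ ω_φ(t, x)` on `Q̃`
  set χ₂ : ℝ × EuclideanSpace ℝ (Fin 3) → ℝ := fun z => angularVorticity (V z.1) z.2 with hχ₂def
  have hχ₂eq : χ₂ = fun z =>
      (cylRadius z.2)⁻¹ * ⟪rotGen z.2, uncurry (fun t y => curl (V t) y) z⟫ := by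
    funext z
    simp only [hχ₂def, angularVorticity_eq_inv_mul_swirl, swirl_eq_inner_rotGen, uncurry]
  have hχ₂C1 : ContDiffOn ℝ 1 χ₂ O := by
    rw [hχ₂eq]
    intro z hz
    have hρ := hSρ z.2 hz.2
    have h1 : ContDiffAt ℝ 1 (fun w : ℝ × EuclideanSpace ℝ (Fin 3) => (cylRadius w.2)⁻¹) z :=
      ((contDiffAt_cylRadius hρ).comp z contDiffAt_snd).inv hρ
    have h2 : ContDiffAt ℝ 1 (fun w : ℝ × EuclideanSpace ℝ (Fin 3) => rotGen w.2) z :=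
      (rotGenL.contDiff.comp contDiff_snd).contDiffAt
    have h3 : ContDiffAt ℝ 1 (uncurry fun t y => curl (V t) y) z :=
      (hC1 z hz).contDiffAt (hOo.mem_nhds hz)
    exact (h1.mul (h2.inner ℝ h3)).contDiffWithinAt
  have hχ₂d : ∀ z ∈ O, DifferentiableAt ℝ χ₂ z := fun z hz =>
    ((hχ₂C1.differentiableOn one_ne_zero) z hz).differentiableAt (hOo.mem_nhds hz)
  have hDχ₂ : ContinuousOn (fderiv ℝ χ₂) O := hχ₂C1.continuousOn_fderiv_of_isOpen hOo le_rfl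
  have hslice : ∀ z ∈ O, fderiv ℝ (fun y => angularVorticity (V z.1) y) z.2 =
      (fderiv ℝ χ₂ z).comp (ContinuousLinearMap.inr ℝ ℝ (EuclideanSpace ℝ (Fin 3))) := by
    intro z hz
    have h := (hχ₂d z hz).hasFDerivAt.comp z.2 (hasFDerivAt_prodMk_right (𝕜 := ℝ) z.1 z.2)
    rw [show (fun y => angularVorticity (V z.1) y) = χ₂ ∘ fun y => (z.1, y) from rfl]
    exact h.fderiv
  have htime : ∀ z ∈ O,
      HasDerivAt (fun s => angularVorticity (V s) z.2)
        (fderiv ℝ χ₂ z ((1 : ℝ), (0 : EuclideanSpace ℝ (Fin 3)))) z.1 := by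
    intro z hz
    have h := (hχ₂d z hz).hasFDerivAt.comp_hasDerivAt z.1
      ((hasDerivAt_id z.1).prodMk (hasDerivAt_const z.1 z.2))
    rw [show (fun s => angularVorticity (V s) z.2) = χ₂ ∘ fun s => (id s, z.2) from rfl]
    exact h
  -- continuity of the coefficients of the cylindrical formulas on `Q̃`
  have hρ1 : ContinuousOn (fun z : ℝ × EuclideanSpace ℝ (Fin 3) => (cylRadius z.2)⁻¹) O :=
    (continuous_cylRadius.comp continuous_snd).continuousOn.inv₀ fun z hz => hSρ z.2 hz.2
  have hρ2 : ContinuousOn (fun z : ℝ × EuclideanSpace ℝ (Fin 3) => (cylRadius z.2 ^ 2)⁻¹) O :=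
    ((continuous_cylRadius.comp continuous_snd).pow 2).continuousOn.inv₀ fun z hz =>
      pow_ne_zero 2 (hSρ z.2 hz.2)
  have hρ3 : ContinuousOn (fun z : ℝ × EuclideanSpace ℝ (Fin 3) => (cylRadius z.2 ^ 3)⁻¹) O :=
    ((continuous_cylRadius.comp continuous_snd).pow 3).continuousOn.inv₀ fun z hz =>
      pow_ne_zero 3 (hSρ z.2 hz.2)
  have hJc : ContinuousOn (fun z : ℝ × EuclideanSpace ℝ (Fin 3) => rotGen z.2) O :=
    (rotGenL.continuous.comp continuous_snd).continuousOn
  have hEc : ContinuousOn (fun z : ℝ × EuclideanSpace ℝ (Fin 3) => eR z.2) O :=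
    continuousOn_eR.comp continuous_snd.continuousOn fun z hz => hSρ z.2 hz.2
  have hJEc : ContinuousOn (fun z : ℝ × EuclideanSpace ℝ (Fin 3) => rotGen (eR z.2)) O :=
    rotGenL.continuous.comp_continuousOn hEc
  -- the structure
  refine ⟨hχ₂C1.continuousOn, ?_, ?_, ?_, ?_, ?_, ?_⟩
  · -- the slices `ω_φ(t, ·) = ϱ⁻¹ η(t, ·)` are `C²` at the points of `Q̃`
    intro z hz
    have hρ := hSρ z.2 hz.2
    rw [angularVorticity_eq_inv_mul_swirl]
    exact ((contDiffAt_cylRadius hρ).inv hρ).mul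
      (contDiffAt_swirl ((contDiffOn_curl_two (hU3 z.1 hz.1) hSo).contDiffAt (hSo.mem_nhds hz.2)))
  · -- `D_xω_φ` is continuous on `Q̃`: a slice of the joint derivative
    exact (hDχ₂.clm_comp continuousOn_const).congr fun z hz => hslice z hz
  · -- `Δ_xω_φ` is continuous on `Q̃`: the formula of `laplacian_angularVorticity`
    have hformula : ∀ z ∈ O, (Δ fun y => angularVorticity (V z.1) y) z.2 =
        (cylRadius z.2)⁻¹ * (⟪rotGen z.2, (Δ (curl (V z.1))) z.2⟫ +
            2 * (fderiv ℝ (curl (V z.1)) z.2 (EuclideanSpace.single 0 1) 1 -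
              fderiv ℝ (curl (V z.1)) z.2 (EuclideanSpace.single 1 1) 0)) -
          2 * (cylRadius z.2 ^ 2)⁻¹ *
            (⟪rotGen z.2, fderiv ℝ (curl (V z.1)) z.2 (eR z.2)⟫ +
              ⟪rotGen (eR z.2), curl (V z.1) z.2⟫) +
          (cylRadius z.2 ^ 3)⁻¹ * ⟪rotGen z.2, curl (V z.1) z.2⟫ := by
      intro z hz
      rw [laplacian_angularVorticity hSo (hU3 z.1 hz.1) hz.2 (hSρ z.2 hz.2),
        fderiv_swirl_apply (hωd z hz), swirl_eq_inner_rotGen]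
    refine ContinuousOn.congr ?_ hformula
    have hD0 : ContinuousOn (fun z : ℝ × EuclideanSpace ℝ (Fin 3) =>
        fderiv ℝ (curl (V z.1)) z.2 (EuclideanSpace.single 0 1) 1) O :=
      ContinuousOn.euclidean_coord (hDω.clm_apply continuousOn_const) 1
    have hD1 : ContinuousOn (fun z : ℝ × EuclideanSpace ℝ (Fin 3) =>
        fderiv ℝ (curl (V z.1)) z.2 (EuclideanSpace.single 1 1) 0) O :=
      ContinuousOn.euclidean_coord (hDω.clm_apply continuousOn_const) 0
    exact ((hρ1.mul ((hJc.inner hΔω).add (continuousOn_const.mul (hD0.sub hD1)))).sub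
      ((continuousOn_const.mul hρ2).mul
        ((hJc.inner (hDω.clm_apply hEc)).add (hJEc.inner hω0)))).add
      (hρ3.mul (hJc.inner hω0))
  · -- `ω_φ(·, x)` is differentiable in time
    exact fun z hz => (hχt z.1 hz.1 z.2 hz.2).differentiableAt
  · -- `∂ₜω_φ` is continuous on `Q̃`: a slice of the joint derivative
    have hpt : ∀ z ∈ O, timeDeriv (fun t x => angularVorticity (V t) x) z.1 z.2 =
        fderiv ℝ χ₂ z ((1 : ℝ), (0 : EuclideanSpace ℝ (Fin 3))) := fun z hz => (htime z hz).deriv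
    exact (hDχ₂.clm_apply continuousOn_const).congr hpt
  · -- the equation (4.5)
    intro z hz
    have ht : timeDeriv (fun t x => angularVorticity (V t) x) z.1 z.2 =
        (cylRadius z.2)⁻¹ * ⟪rotGen z.2, (Δ (curl (V z.1))) z.2 -
          fderiv ℝ (curl (V z.1)) z.2 (V z.1 z.2) + fderiv ℝ (V z.1) z.2 (curl (V z.1) z.2)⟫ :=
      (hχt z.1 hz.1 z.2 hz.2).deriv
    rw [ht]
    exact inv_cylRadius_mul_inner_rotGen_vorticityRHS hSo (hU3 z.1 hz.1) hz.2 (hSρ z.2 hz.2)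
      (hJu z hz) (hJω z hz)

end SereginZajaczkowski2007

end Literature.Analysis.FluidPDE
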